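import Summits.Ventures.GridStability.Models.DroopQVDeflateRows
import Literature.Computation.Certificates.PsdRoundedTwin

/-!
# GridStability/Models/DroopQVModelTwin — the MODEL-TWIN lever for deflation-lane RATE certificates at operator size: certify `H` of a ROUNDED model matrix and pay the model rounding entrywise

Cell `gridfusion` (LADDER-GRIDFUSION, APEX LINE rung G3.b; seat gridfusion-model-8 (g2); next-wave LEVER for memo §3/§5, measured on the
`n = 10` census object in `HOME/lean/model-8/…/NE39DroopQVDeflateTwin.lean`). Context: `Models/DroopQVDeflateRows.lean` (p536118) lets an instance
file EVALUATE the `900` entries of `H − δ·1 = lyapRows n r₀ δ S J′` in the kernel; the cost is `2n³` products of certificate integers by the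
HIGH-height exact entries of the deflated Jacobian `J′` (≤ 101-digit rationals at `n = 10`; `Models/NE39DroopQVDeflate.lean` = 48 s farm wall,
≈ 40 s of it here), i.e. `O(n³·height(J′))`, which does not reach operator size (`n ≈ 40–120`). LEVER (Rump's perturbation step once more
[cite: Rump1999VerifiedLargeSystems, §4 Algorithm 4.1 step 7], `PSD.quadForm_nonneg_of_near`): round the MODEL matrix as well — `J̃` a
low-height dyadic literal with `|J′ − J̃| ≤ η` entrywise (ONE kernel pass over the `n²` exact entries, which may be the instance's ℚ-twin
expression itself — no exact literal needed), certify `H(J̃) − δ·1 ⪰ 0` on SMALL heights (rounded twin or direct Gram), check the row sums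
`Σ_k |S_ik| ≤ ρ` of the integer Lyapunov matrix, and conclude `H(J′) − δ₀·1 ⪰ 0` whenever `n·2ηρ + δ₀ ≤ δ`, because
`H(J′) − H(J̃) = S(J̃ − J′) + (S(J̃ − J′))ᵀ` is entrywise `≤ 2ηρ`. Kernel work `O(n²·height(J′)) + O(n³·height(J̃))`; literal size `O(n²)` small
integers. Declarations (namespace `DeflRows`): Bool checkers `allClose`, `rowAbsSumLe` with semantics; `abs_lyapRows_sub_le` (row-form defect
bound); **`quadForm_nonneg_of_modelTwin`** (matrix form) and **`quadForm_nonneg_of_modelTwin_rows`** (the shape instance files use).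
THREE COLUMNS. CERTIFIED (kernel): list/matrix algebra only; no instance, no parameter, no certificate. No sentence of this file says a grid,
a microgrid or a converter is stable.
-/

namespace Summit.Ventures.GridStability.Models

open Matrix Literature.Computation.Certificates

namespace DeflRows

/-- Entrywise closeness of two row tables on the `n × n` window: `|A_ij − B_ij| ≤ η` (Bool, kernel-evaluable). [folklore] -/
def allClose (n : ℕ) (η : ℚ) (A B : List (List ℚ)) : Bool :=
  (List.finRange n).all fun i : Fin n => (List.finRange n).all fun j : Fin n =>
    decide (|(A.getD i.val []).getD j.val 0 - (B.getD i.val []).getD j.val 0| ≤ η)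

/-- Row-sum bound `Σ_k |S_ik| ≤ ρ` for every row of the `n × n` window (Bool, kernel-evaluable). [folklore] -/
def rowAbsSumLe (n : ℕ) (ρ : ℚ) (S : List (List ℚ)) : Bool :=
  (List.finRange n).all fun i : Fin n => decide ((((List.finRange n).map fun k : Fin n => |(S.getD i.val []).getD k.val 0|).sum) ≤ ρ)

/-- Semantics of `allClose`. [folklore] -/
theorem abs_sub_le_of_allClose {n : ℕ} {η : ℚ} {A B : List (List ℚ)} (h : allClose n η A B = true) (i j : Fin n) :
    |matrixOfRows n n A i j - matrixOfRows n n B i j| ≤ η := by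
  unfold allClose at h
  rw [List.all_eq_true] at h
  have hi := h i (List.mem_finRange i)
  rw [List.all_eq_true] at hi
  have hij := hi j (List.mem_finRange j)
  rw [decide_eq_true_eq] at hij
  simpa [matrixOfRows_apply] using hij

/-- Semantics of `rowAbsSumLe`. [folklore] -/
theorem sum_abs_le_of_rowAbsSumLe {n : ℕ} {ρ : ℚ} {S : List (List ℚ)} (h : rowAbsSumLe n ρ S = true) (i : Fin n) :
    ∑ k, |matrixOfRows n n S i k| ≤ ρ := by
  unfold rowAbsSumLe at h
  rw [List.all_eq_true] at h
  have hi := h i (List.mem_finRange i)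
  rw [decide_eq_true_eq, ← Fin.sum_univ_def] at hi
  simpa [matrixOfRows_apply] using hi

/-- Entrywise defect bound: `|H(J)_ij − H(J̃)_ij| ≤ 2ηρ` for `H(X) = matrixOfRows n n (lyapRows n r₀ 0 S X)`, when `|J − J̃| ≤ η` entrywise
and every row of `S` has absolute sum `≤ ρ`. [folklore] -/
theorem abs_lyapRows_sub_le {n : ℕ} {η ρ : ℚ} (r₀ : ℚ) {S J Jt : List (List ℚ)}
    (hclose : allClose n η J Jt = true) (hrow : rowAbsSumLe n ρ S = true) (i j : Fin n) :
    |matrixOfRows n n (lyapRows n r₀ 0 S J) i j - matrixOfRows n n (lyapRows n r₀ 0 S Jt) i j| ≤ 2 * η * ρ := by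
  have hη : 0 ≤ η := (abs_nonneg _).trans (abs_sub_le_of_allClose hclose i j)
  have hrowi := sum_abs_le_of_rowAbsSumLe hrow i
  have hrowj := sum_abs_le_of_rowAbsSumLe hrow j
  rw [matrixOfRows_lyapRows, matrixOfRows_lyapRows]
  simp only [Matrix.add_apply, Matrix.sub_apply, Matrix.smul_apply, Matrix.transpose_apply, Matrix.mul_apply,
    Matrix.neg_apply, Matrix.one_apply, smul_eq_mul, zero_mul]
  set MS := matrixOfRows n n S
  set MJ := matrixOfRows n n J
  set MJt := matrixOfRows n n Jt
  have h1 : |∑ k, MS i k * -MJ k j - ∑ k, MS i k * -MJt k j| ≤ η * ρ := by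
    rw [← Finset.sum_sub_distrib]
    calc |∑ k, (MS i k * -MJ k j - MS i k * -MJt k j)| ≤ ∑ k, |MS i k * -MJ k j - MS i k * -MJt k j| :=
          Finset.abs_sum_le_sum_abs _ _
      _ = ∑ k, |MS i k| * |MJt k j - MJ k j| := Finset.sum_congr rfl fun k _ => by
          rw [← abs_mul]; congr 1; ring
      _ ≤ ∑ k, |MS i k| * η := Finset.sum_le_sum fun k _ =>
          mul_le_mul_of_nonneg_left (by rw [abs_sub_comm]; exact abs_sub_le_of_allClose hclose k j) (abs_nonneg _)
      _ = (∑ k, |MS i k|) * η := (Finset.sum_mul _ _ _).symm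
      _ ≤ ρ * η := mul_le_mul_of_nonneg_right hrowi hη
      _ = η * ρ := mul_comm _ _
  have h2 : |∑ k, MS j k * -MJ k i - ∑ k, MS j k * -MJt k i| ≤ η * ρ := by
    rw [← Finset.sum_sub_distrib]
    calc |∑ k, (MS j k * -MJ k i - MS j k * -MJt k i)| ≤ ∑ k, |MS j k * -MJ k i - MS j k * -MJt k i| :=
          Finset.abs_sum_le_sum_abs _ _
      _ = ∑ k, |MS j k| * |MJt k i - MJ k i| := Finset.sum_congr rfl fun k _ => by
          rw [← abs_mul]; congr 1; ring
      _ ≤ ∑ k, |MS j k| * η := Finset.sum_le_sum fun k _ =>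
          mul_le_mul_of_nonneg_left (by rw [abs_sub_comm]; exact abs_sub_le_of_allClose hclose k i) (abs_nonneg _)
      _ = (∑ k, |MS j k|) * η := (Finset.sum_mul _ _ _).symm
      _ ≤ ρ * η := mul_le_mul_of_nonneg_right hrowj hη
      _ = η * ρ := mul_comm _ _
  have key : (∑ k, MS i k * -MJ k j + ∑ k, MS j k * -MJ k i - 2 * r₀ * MS i j - 0)
      - (∑ k, MS i k * -MJt k j + ∑ k, MS j k * -MJt k i - 2 * r₀ * MS i j - 0)
      = (∑ k, MS i k * -MJ k j - ∑ k, MS i k * -MJt k j) + (∑ k, MS j k * -MJ k i - ∑ k, MS j k * -MJt k i) := by ring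
  rw [key]
  calc _ ≤ |∑ k, MS i k * -MJ k j - ∑ k, MS i k * -MJt k j| + |∑ k, MS j k * -MJ k i - ∑ k, MS j k * -MJt k i| := abs_add_le _ _
    _ ≤ η * ρ + η * ρ := add_le_add h1 h2
    _ = 2 * η * ρ := by ring

/-- **The model-twin lever (matrix form).** `M_S` with row absolute sums `≤ ρ`, an exact model matrix `M_J` and a rounded one `M_J̃` with
`|M_J − M_J̃| ≤ η` entrywise; if `yᵀ·H(M_J̃)·y ≥ δ‖y‖²` for all `y` (e.g. from a rounded twin of the `δ`-shifted rows `lyapRows n r₀ δ S J̃`) and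
`n·(2ηρ) + δ₀ ≤ δ`, then `H(M_J) − δ₀·1` has nonnegative quadratic form, where `H(X) = M_S(−X) + (M_S(−X))ᵀ − (2r₀)·M_S` — over any linearly
ordered field (take `δ₀ > 0` for positive definiteness downstream). The kernel never multiplies by an exact entry of `M_J`.
[cite: Rump1999VerifiedLargeSystems, §4 Algorithm 4.1 step 7] -/
theorem quadForm_nonneg_of_modelTwin {R : Type*} [Field R] [LinearOrder R] [IsStrictOrderedRing R] {n : ℕ} {r₀ δ δ₀ η ρ : ℚ}
    {MS MJ MJt : Matrix (Fin n) (Fin n) ℚ}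
    (hC : ∀ y : Fin n → R, ((δ : ℚ) : R) * ∑ i, y i ^ 2
      ≤ ∑ i, ∑ j, y i * (((MS * (-MJt) + (MS * (-MJt))ᵀ - (2 * r₀) • MS) i j : ℚ) : R) * y j)
    (hclose : ∀ i j, |MJ i j - MJt i j| ≤ η) (hrow : ∀ i, ∑ k, |MS i k| ≤ ρ) (hmargin : (n : ℚ) * (2 * η * ρ) + δ₀ ≤ δ)
    (y : Fin n → R) :
    0 ≤ ∑ i, ∑ j, y i * (((MS * (-MJ) + (MS * (-MJ))ᵀ - (2 * r₀) • MS - δ₀ • (1 : Matrix (Fin n) (Fin n) ℚ)) i j : ℚ) : R) * y j := by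
  let A : Matrix (Fin n) (Fin n) R := fun i j =>
    (((MS * (-MJ) + (MS * (-MJ))ᵀ - (2 * r₀) • MS - δ₀ • (1 : Matrix (Fin n) (Fin n) ℚ)) i j : ℚ) : R)
  let C : Matrix (Fin n) (Fin n) R := fun i j =>
    (((MS * (-MJt) + (MS * (-MJt))ᵀ - (2 * r₀) • MS - δ₀ • (1 : Matrix (Fin n) (Fin n) ℚ)) i j : ℚ) : R)
  -- (1) the rounded model's shifted form dominates (δ − δ₀)‖y‖²
  have hCform : ∀ z : Fin n → R, (((δ - δ₀ : ℚ)) : R) * ∑ i, z i ^ 2 ≤ ∑ i, ∑ j, z i * C i j * z j := by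
    intro z
    have h0 := hC z
    have hdiag : ∀ i : Fin n, ∑ j, z i * (((if i = j then δ₀ else 0 : ℚ) : R)) * z j = ((δ₀ : ℚ) : R) * z i ^ 2 := by
      intro i
      have : ∀ j : Fin n, z i * (((if i = j then δ₀ else 0 : ℚ) : R)) * z j = if i = j then ((δ₀ : ℚ) : R) * z i ^ 2 else 0 := by
        intro j; split_ifs with hij
        · subst hij; ring
        · simp
      simp_rw [this]; simp
    have hsplit : ∑ i, ∑ j, z i * C i j * z j
        = (∑ i, ∑ j, z i * (((MS * (-MJt) + (MS * (-MJt))ᵀ - (2 * r₀) • MS) i j : ℚ) : R) * z j)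
          - ((δ₀ : ℚ) : R) * ∑ i, z i ^ 2 := by
      rw [Finset.mul_sum, ← Finset.sum_sub_distrib]
      refine Finset.sum_congr rfl fun i _ => ?_
      rw [← hdiag i, ← Finset.sum_sub_distrib]
      refine Finset.sum_congr rfl fun j _ => ?_
      simp only [C, Matrix.sub_apply, Matrix.smul_apply, Matrix.one_apply, smul_eq_mul, mul_ite, mul_one, mul_zero]
      push_cast; ring
    rw [hsplit]; push_cast; linarith
  -- (2) entrywise defect ≤ 2ηρ
  have hE : ∀ i j, |A i j - C i j| ≤ (((2 * η * ρ : ℚ)) : R) := by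
    intro i j
    have hη : 0 ≤ η := (abs_nonneg _).trans (hclose i j)
    have h1 : |∑ k, MS i k * -MJ k j - ∑ k, MS i k * -MJt k j| ≤ η * ρ := by
      rw [← Finset.sum_sub_distrib]
      calc |∑ k, (MS i k * -MJ k j - MS i k * -MJt k j)| ≤ ∑ k, |MS i k * -MJ k j - MS i k * -MJt k j| :=
            Finset.abs_sum_le_sum_abs _ _
        _ = ∑ k, |MS i k| * |MJt k j - MJ k j| := Finset.sum_congr rfl fun k _ => by
            rw [← abs_mul]; congr 1; ring
        _ ≤ ∑ k, |MS i k| * η := Finset.sum_le_sum fun k _ =>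
            mul_le_mul_of_nonneg_left (by rw [abs_sub_comm]; exact hclose k j) (abs_nonneg _)
        _ = (∑ k, |MS i k|) * η := (Finset.sum_mul _ _ _).symm
        _ ≤ ρ * η := mul_le_mul_of_nonneg_right (hrow i) hη
        _ = η * ρ := mul_comm _ _
    have h2 : |∑ k, MS j k * -MJ k i - ∑ k, MS j k * -MJt k i| ≤ η * ρ := by
      rw [← Finset.sum_sub_distrib]
      calc |∑ k, (MS j k * -MJ k i - MS j k * -MJt k i)| ≤ ∑ k, |MS j k * -MJ k i - MS j k * -MJt k i| :=
            Finset.abs_sum_le_sum_abs _ _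
        _ = ∑ k, |MS j k| * |MJt k i - MJ k i| := Finset.sum_congr rfl fun k _ => by
            rw [← abs_mul]; congr 1; ring
        _ ≤ ∑ k, |MS j k| * η := Finset.sum_le_sum fun k _ =>
            mul_le_mul_of_nonneg_left (by rw [abs_sub_comm]; exact hclose k i) (abs_nonneg _)
        _ = (∑ k, |MS j k|) * η := (Finset.sum_mul _ _ _).symm
        _ ≤ ρ * η := mul_le_mul_of_nonneg_right (hrow j) hη
        _ = η * ρ := mul_comm _ _
    have hq : |((MS * (-MJ) + (MS * (-MJ))ᵀ - (2 * r₀) • MS - δ₀ • (1 : Matrix (Fin n) (Fin n) ℚ)) i j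
        - (MS * (-MJt) + (MS * (-MJt))ᵀ - (2 * r₀) • MS - δ₀ • (1 : Matrix (Fin n) (Fin n) ℚ)) i j)| ≤ 2 * η * ρ := by
      simp only [Matrix.add_apply, Matrix.sub_apply, Matrix.smul_apply, Matrix.transpose_apply, Matrix.mul_apply,
        Matrix.neg_apply, smul_eq_mul]
      have key : (∑ k, MS i k * -MJ k j + ∑ k, MS j k * -MJ k i - 2 * r₀ * MS i j - δ₀ * (1 : Matrix (Fin n) (Fin n) ℚ) i j)
          - (∑ k, MS i k * -MJt k j + ∑ k, MS j k * -MJt k i - 2 * r₀ * MS i j - δ₀ * (1 : Matrix (Fin n) (Fin n) ℚ) i j)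
          = (∑ k, MS i k * -MJ k j - ∑ k, MS i k * -MJt k j) + (∑ k, MS j k * -MJ k i - ∑ k, MS j k * -MJt k i) := by ring
      rw [key]
      calc _ ≤ |∑ k, MS i k * -MJ k j - ∑ k, MS i k * -MJt k j| + |∑ k, MS j k * -MJ k i - ∑ k, MS j k * -MJt k i| :=
            abs_add_le _ _
        _ ≤ η * ρ + η * ρ := add_le_add h1 h2
        _ = 2 * η * ρ := by ring
    have : A i j - C i j = ((((MS * (-MJ) + (MS * (-MJ))ᵀ - (2 * r₀) • MS - δ₀ • (1 : Matrix (Fin n) (Fin n) ℚ)) i j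
        - (MS * (-MJt) + (MS * (-MJt))ᵀ - (2 * r₀) • MS - δ₀ • (1 : Matrix (Fin n) (Fin n) ℚ)) i j : ℚ)) : R) := by
      push_cast; rfl
    rw [this, ← Rat.cast_abs]
    exact_mod_cast hq
  -- (3) margin
  have hm : (n : R) * (((2 * η * ρ : ℚ)) : R) ≤ (((δ - δ₀ : ℚ)) : R) := by
    have : (n : ℚ) * (2 * η * ρ) ≤ δ - δ₀ := by linarith
    exact_mod_cast this
  exact PSD.quadForm_nonneg_of_near A C hCform hE hm y

/-- **The model-twin lever (row form, the shape instance files use).** `Hrows` = ANY row presentation of the `δ`-SHIFTED `H` of the rounded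
model (`lyapRows n r₀ δ S J̃` via `matrixOfRows_lyapRows`, or the sequential-access `lyapRowsSeq` of `Models/DroopQVDeflateSeq.lean`) and `hC` the
nonnegativity of its quadratic form (the conclusion of `PSD.quadForm_nonneg_of_roundedTwin`); `hclose` = entrywise closeness of ANY
rational matrix `M_J` (e.g. the exact deflated Jacobian, evaluated by the kernel once per entry) to `matrixOfRows n n J̃`; `hrow` = the Bool
row-sum check; conclusion = the PSD hypothesis shape for `M_S(−M_J) + (M_S(−M_J))ᵀ − (2r₀)·M_S − δ₀·1`. [folklore] -/
theorem quadForm_nonneg_of_modelTwin_rows {R : Type*} [Field R] [LinearOrder R] [IsStrictOrderedRing R] {n : ℕ} {r₀ δ δ₀ η ρ : ℚ}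
    {S Jt Hrows : List (List ℚ)} {MJ : Matrix (Fin n) (Fin n) ℚ}
    (hH : matrixOfRows n n Hrows = matrixOfRows n n S * (-matrixOfRows n n Jt) + (matrixOfRows n n S * (-matrixOfRows n n Jt))ᵀ
      - (2 * r₀) • matrixOfRows n n S - δ • (1 : Matrix (Fin n) (Fin n) ℚ))
    (hC : ∀ y : Fin n → R, 0 ≤ ∑ i, ∑ j, y i * ((matrixOfRows n n Hrows i j : ℚ) : R) * y j)
    (hclose : ∀ i j, |MJ i j - matrixOfRows n n Jt i j| ≤ η) (hrow : rowAbsSumLe n ρ S = true)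
    (hmargin : (n : ℚ) * (2 * η * ρ) + δ₀ ≤ δ) (y : Fin n → R) :
    0 ≤ ∑ i, ∑ j, y i * (((matrixOfRows n n S * (-MJ) + (matrixOfRows n n S * (-MJ))ᵀ
      - (2 * r₀) • matrixOfRows n n S - δ₀ • (1 : Matrix (Fin n) (Fin n) ℚ)) i j : ℚ) : R) * y j := by
  refine quadForm_nonneg_of_modelTwin (MJt := matrixOfRows n n Jt) (fun z => ?_) hclose (sum_abs_le_of_rowAbsSumLe hrow) hmargin y
  have h0 := hC z
  have hshift : ∀ i j : Fin n, matrixOfRows n n Hrows i j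
      = (matrixOfRows n n S * (-matrixOfRows n n Jt) + (matrixOfRows n n S * (-matrixOfRows n n Jt))ᵀ
          - (2 * r₀) • matrixOfRows n n S) i j - (if i = j then δ else 0) := by
    intro i j
    rw [hH]
    simp only [Matrix.sub_apply, Matrix.smul_apply, Matrix.one_apply, smul_eq_mul, mul_ite, mul_one, mul_zero]
  have hdiag : ∀ i : Fin n, ∑ j, z i * (((if i = j then δ else 0 : ℚ) : R)) * z j = ((δ : ℚ) : R) * z i ^ 2 := by
    intro i
    have : ∀ j : Fin n, z i * (((if i = j then δ else 0 : ℚ) : R)) * z j = if i = j then ((δ : ℚ) : R) * z i ^ 2 else 0 := by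
      intro j; split_ifs with hij
      · subst hij; ring
      · simp
    simp_rw [this]; simp
  have hsplit : ∑ i, ∑ j, z i * ((matrixOfRows n n Hrows i j : ℚ) : R) * z j
      = (∑ i, ∑ j, z i * (((matrixOfRows n n S * (-matrixOfRows n n Jt) + (matrixOfRows n n S * (-matrixOfRows n n Jt))ᵀ
          - (2 * r₀) • matrixOfRows n n S) i j : ℚ) : R) * z j) - ((δ : ℚ) : R) * ∑ i, z i ^ 2 := by
    rw [Finset.mul_sum, ← Finset.sum_sub_distrib]
    refine Finset.sum_congr rfl fun i _ => ?_
    rw [← hdiag i, ← Finset.sum_sub_distrib]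
    refine Finset.sum_congr rfl fun j _ => ?_
    rw [hshift i j]; push_cast; ring
  rw [hsplit] at h0
  linarith

end DeflRows

end Summit.Ventures.GridStability.Models
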